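import Summits.Ventures.HodgeRepro2.T5BergmanSchurGeneral

/-!
# Orbit totality in the weighted Bergman model

A consequence of the general Schur relation `∫_G |⟨π_k(g) f, h⟩_k|² dμ_R = ⟨f,f⟩_k ⟨h,h⟩_k/(k-1)`
(`T5BergmanSchurGeneral.schur`): if a matrix coefficient `g ↦ ⟨π_k(g) f, h⟩_k` vanishes identically on
`SU(1,1)` then `f = 0` or `h = 0` on the disc (`eq_zero_or_eq_zero_of_forall_pairing_act_eq_zero`) — so
the orbit `π_k(G) h` of every non-zero `h ∈ A_k` is TOTAL in `A_k` (`orbit_total`: a vector orthogonal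
to the whole orbit vanishes), and two non-zero vectors always have a non-vanishing coefficient
(`exists_pairing_act_ne_zero`). The step from `⟨f,f⟩_k = 0` to `f = 0` on the disc is
`T5BergmanPointwise.pairing_self_eq_zero_iff`.

Blind lane: Mathlib + the HodgeRepro2 prefix only; no sorry; axioms ⊆ {propext, Classical.choice,
Quot.sound}.
-/

namespace Summit.Ventures.HodgeRepro2.T5BergmanOrbitTotal

open MeasureTheory MeasureTheory.Measure Metric Filter Topology
open T5PoincareDensity T5SU11Unimodular T5SU11Fibration T5HaarCircle T5SU11CoefficientL2
open T5BergmanCoefficient T5BergmanPairing T5BergmanUnitary T5BergmanFourier T5BergmanParseval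
  T5BergmanPointwise T5BergmanActStable T5BergmanMatrixCoeff T5BergmanSchurGeneral
open scoped Real

variable [MeasurableSpace Circle] [BorelSpace Circle]

/-- **A vanishing coefficient forces a vanishing vector**: if `⟨π_k(g) f, h⟩_k = 0` for every
`g ∈ SU(1,1)`, with `f, h ∈ A_k` holomorphic (`k ≥ 2`), then `f = 0` on the disc or `h = 0` on the disc. -/
theorem eq_zero_or_eq_zero_of_forall_pairing_act_eq_zero (k : ℕ) (hk : 2 ≤ k) (f h : ℂ → ℂ)
    (hf : DifferentiableOn ℂ f (ball 0 1))
    (hfint : IntegrableOn (fun w => ‖f w‖ ^ 2 * (1 - ‖w‖ ^ 2) ^ (k - 2)) (ball (0 : ℂ) 1))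
    (hh : DifferentiableOn ℂ h (ball 0 1))
    (hhint : IntegrableOn (fun w => ‖h w‖ ^ 2 * (1 - ‖w‖ ^ 2) ^ (k - 2)) (ball (0 : ℂ) 1))
    (h0 : ∀ g : SU11, pairing k (act k g f) h = 0) :
    (∀ z ∈ ball (0 : ℂ) 1, f z = 0) ∨ ∀ z ∈ ball (0 : ℂ) 1, h z = 0 := by
  have hs := schur k hk f h hf hfint hh hhint
  have hzero : ∀ g : SU11, ‖pairing k (act k g f) h‖ ^ 2 = 0 := fun g => by
    rw [h0 g, norm_zero, zero_pow two_ne_zero]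
  simp_rw [hzero, integral_zero] at hs
  have hk1 : (0 : ℝ) < (k : ℝ) - 1 := by
    have : (2 : ℝ) ≤ k := by exact_mod_cast hk
    linarith
  have hprod : (pairing k f f).re * (pairing k h h).re = 0 := by
    rw [eq_comm, div_eq_zero_iff] at hs
    exact hs.resolve_right hk1.ne'
  rcases mul_eq_zero.mp hprod with h1 | h1
  · left
    refine (pairing_self_eq_zero_iff k f hf hfint).mp ?_
    rw [pairing_self_eq_re k f, h1, Complex.ofReal_zero]
  · right
    refine (pairing_self_eq_zero_iff k h hh hhint).mp ?_
    rw [pairing_self_eq_re k h, h1, Complex.ofReal_zero]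

/-- **Orbit totality**: if `h ∈ A_k` is not identically zero on the disc and `f ∈ A_k` is orthogonal to the
whole orbit `π_k(G) h` (i.e. `⟨π_k(g) f, h⟩_k = 0` for all `g`), then `f = 0` on the disc. -/
theorem orbit_total (k : ℕ) (hk : 2 ≤ k) (f h : ℂ → ℂ) (hf : DifferentiableOn ℂ f (ball 0 1))
    (hfint : IntegrableOn (fun w => ‖f w‖ ^ 2 * (1 - ‖w‖ ^ 2) ^ (k - 2)) (ball (0 : ℂ) 1))
    (hh : DifferentiableOn ℂ h (ball 0 1))
    (hhint : IntegrableOn (fun w => ‖h w‖ ^ 2 * (1 - ‖w‖ ^ 2) ^ (k - 2)) (ball (0 : ℂ) 1))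
    (hne : ∃ z ∈ ball (0 : ℂ) 1, h z ≠ 0) (h0 : ∀ g : SU11, pairing k (act k g f) h = 0) :
    ∀ z ∈ ball (0 : ℂ) 1, f z = 0 := by
  rcases eq_zero_or_eq_zero_of_forall_pairing_act_eq_zero k hk f h hf hfint hh hhint h0 with h1 | h1
  · exact h1
  · obtain ⟨z, hz, hz0⟩ := hne
    exact absurd (h1 z hz) hz0

/-- **Orbit totality, the other slot**: if `f ∈ A_k` is not identically zero on the disc and
`⟨π_k(g) f, h⟩_k = 0` for all `g`, then `h = 0` on the disc. -/
theorem orbit_total' (k : ℕ) (hk : 2 ≤ k) (f h : ℂ → ℂ) (hf : DifferentiableOn ℂ f (ball 0 1))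
    (hfint : IntegrableOn (fun w => ‖f w‖ ^ 2 * (1 - ‖w‖ ^ 2) ^ (k - 2)) (ball (0 : ℂ) 1))
    (hh : DifferentiableOn ℂ h (ball 0 1))
    (hhint : IntegrableOn (fun w => ‖h w‖ ^ 2 * (1 - ‖w‖ ^ 2) ^ (k - 2)) (ball (0 : ℂ) 1))
    (hne : ∃ z ∈ ball (0 : ℂ) 1, f z ≠ 0) (h0 : ∀ g : SU11, pairing k (act k g f) h = 0) :
    ∀ z ∈ ball (0 : ℂ) 1, h z = 0 := by
  rcases eq_zero_or_eq_zero_of_forall_pairing_act_eq_zero k hk f h hf hfint hh hhint h0 with h1 | h1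
  · obtain ⟨z, hz, hz0⟩ := hne
    exact absurd (h1 z hz) hz0
  · exact h1

/-- **Two non-zero vectors have a non-vanishing coefficient**: for `f, h ∈ A_k` holomorphic, neither
identically zero on the disc, there is `g ∈ SU(1,1)` with `⟨π_k(g) f, h⟩_k ≠ 0`. -/
theorem exists_pairing_act_ne_zero (k : ℕ) (hk : 2 ≤ k) (f h : ℂ → ℂ)
    (hf : DifferentiableOn ℂ f (ball 0 1))
    (hfint : IntegrableOn (fun w => ‖f w‖ ^ 2 * (1 - ‖w‖ ^ 2) ^ (k - 2)) (ball (0 : ℂ) 1))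
    (hh : DifferentiableOn ℂ h (ball 0 1))
    (hhint : IntegrableOn (fun w => ‖h w‖ ^ 2 * (1 - ‖w‖ ^ 2) ^ (k - 2)) (ball (0 : ℂ) 1))
    (hfne : ∃ z ∈ ball (0 : ℂ) 1, f z ≠ 0) (hhne : ∃ z ∈ ball (0 : ℂ) 1, h z ≠ 0) :
    ∃ g : SU11, pairing k (act k g f) h ≠ 0 := by
  by_contra hcon
  have h0 : ∀ g : SU11, pairing k (act k g f) h = 0 := fun g => by
    by_contra hg
    exact hcon ⟨g, hg⟩
  obtain ⟨z, hz, hz0⟩ := hfne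
  exact hz0 (orbit_total k hk f h hf hfint hh hhint hhne h0 z hz)

end Summit.Ventures.HodgeRepro2.T5BergmanOrbitTotal
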